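import Summits.QuantumFields.BalabanUV.T4Continuum.Support.ShellMeasureLandauHolonomyClamp

/-!
# `T4Continuum.ShellMeasureLandauHolonomyEnd` — THE S22 ROAD'S END ON THE CHART, CLASSIFIER SIDE: REALIZED (M1) PER
# SLOT (E2′) FOR THE CANONICAL LANDAU CLASSIFIER, with `hol`, `hhol`, `hAN`, `hcont`, `hRad` NO LONGER BINDERS
(cell `pub-balaban`, sub-cell `t4`, spine estimate NE7c (node U5b); NE7c formalisation swarm, crew seat
`b2b-balaban-t4-ne7c-formalise-leaf-05` gen 4 — the junction of S22 file 7″ (`ShellMeasureLandauHolonomyChart`,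
p212418: `hAN`), this seat's `ShellMeasureLandauHolonomyContinuity` (p212890: continuity on the cube) and
`ShellMeasureLandauHolonomyClamp` (p213068: E2′ with `hcontOn`); imports the last ONLY; 0 def, 0 `def … : Prop`,
0 sorry.  A JUNCTION — no new mathematics; its value is the binder list.  v1.1 ADDITIVE: §2
`slotAC_realized_su2_landauChart'` — the same END with `hWS` removed and `hGW`/`hE` asked on `W V ∩ cube` only.)

HONEST FRAMING.  Finite four-torus programme, rung (B)+1 only — NOT infinite volume, NOT a mass gap, NOT the Clay
problem, NOT summit progress; (B), `BetaPertHyp`, (B^μ) not consumed.  NE7c (`T4IndicatorShell.ShellWeightBound`) is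
NOT PRINTED and NOT PROVED; «NE7c ⇐ the named binders».  Nothing printed in [Balaban1985Variational] is asserted: every
analytic input below is a TYPED HYPOTHESIS ((P2), (P4), (118)/(121), (75)/(103), (44)+[4] Prop. 7, (46), (54)), per
exterior configuration `V`, with constants UNIFORM in `V` (that uniformity is itself part of what the displayed
estimates claim; nothing here proves it).

THE ONE THEOREM `slotAC_realized_su2_landauChart`.  E2′
(`ShellMeasureRootCompositionLevelZero.slotAC_realized_su2_of_levelData_cube`) concluded
`SlotAntiConcentration ((fieldMeasure P j SU2).withDensity F) u θ ρ (2(n + β Σ_p L̄_p(d̄_p + 4s̄_p) + B_𝓔)/(1−δ))` from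
measure-side data + level data with the classifier holonomy `hol V p` a FREE function carrying `hcont`, `hAN` (and,
upstream on the S14/S22 road, the dictionary `hhol`).  Here `hol V p` IS the canonical Landau holonomy of the scheme
data at the chart point —
`hol V p := holOf (ℓs p) (y ↦ landauExp (Cf V) (ιs V) (Hop V) (4C₂(ε₄+B₀b)²) (solAt (𝒢 V) 0 (W𝒱 V) ε₄ 0 (H₁ V (Φ V (cplx y))) + H₁ V (Φ V (cplx y))))`
— and the binders `hol`/`hhol`/`hAN`/`hcont`/`hRad` are GONE: `hAN` by 7″ `hAN_landau_chartRay`, `hcont` by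
`continuousOn_landauHol_chartRay` + the clamp (`slotAC_realized_su2_of_levelData_cube_contOn`), `hRad` by `S < r_Φ`.
WHAT REMAINS DISPLAYED (the binder list, = the honest census of the S22 road's classifier side): E2′'s measure-side
data (`T`, `U₀`, `Λ`, `e`, `S`, `c`, `R`, `F`, `hFw`, `hfin`, `u`), the DICTIONARIES `hRdict` (block weight) and
`hudict` (now: «the slot's tested variable read through the chart IS the classifier of the CANONICAL Landau
holonomy»), the window `hJW`/`hJ`/`hWS`, SM-L3 `hGW` (weight words `G`, free), SM-L4 `hE`, the numbers, SM-L2 `hSM` in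
the currency `Rad = r_Φ/S`, `H_AN = e^{m·κ((ε₄+B₀b) + 4C₂B₀(ε₄+B₀b)²)} − 1`, and per `V` the S22 data binders: (P2) `h𝒢`,
(P4) `hW`, (118)/(121) at `(j, θ, a) = (0, 0, B₀b)`, (103) `hH₁`, (75) `Φ V` holomorphic on the polydisc `‖z‖ < r_Φ`
with `Φ V 0 = 0`, `‖Φ V z‖ < b`, `S < r_Φ`, (44)+[4] Prop. 7 `hCq`/`hCd`, the scaling `hι`, (46) `hH`, the
(54)-smallness, the read-outs (`‖ℓ Y‖ ≤ κ‖Y‖`, length `≤ m`).  NOT an instance of Bałaban's minimiser; (M1)₀ realized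
≠ NE7c; NE7c NOT PROVED; spine PROVED 0/9.  HONEST DEPENDENCY (cell): continuum YM on T⁴ ⇐ BetaPertH ∧ nine spine
estimates (0/9 proved); BetaPertH ⇐ (D1) ∧ (D4) ∧ CAP+tail; G-an2-4 gates asym, D1 and NE2/3/4.
-/

noncomputable section

open Set Metric NormedSpace Function MeasureTheory

namespace Summit.QuantumFields.BalabanUV.T4Continuum.ShellMeasureLandauHolonomyEnd

open scoped ENNReal
open Literature.MathematicalPhysics.QuantumFieldTheory.Balaban1983to89
open B11Prop6Scheme (Prop4Hyp)
open GaugeField (GaugeInvariant)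
open T4ShellMeasure (SlotAntiConcentration)
open T4CubePoincare (cube mem_cube_iff)
open T4CubeChartGnomonic (SU2)
open T4CubeChartExp (expWindowDensity expFibreChart)
open T4ShellMeasureDet (blockLaw)
open T4TreeGaugeFixing (NoClosedLoop fixTo)
open ShellMeasureWilsonTrace (TraceData)
open ShellMeasureWilsonMoving (MLetter mwordEval mdFro sSum lSum)
open ShellMeasureLevelAssembly (classifier weight)
open ShellMeasureLandauHolonomy (solAt landauExp)
open ShellMeasureLandauHolonomyChart (holOf cplx hAN_landau_chartRay)
open ShellMeasureLandauHolonomyContinuity (continuousOn_landauHol_chartRay)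
open ShellMeasureScalingSU2 (smul_mem_cube)
open ShellMeasureLandauHolonomyClamp (slotAC_realized_su2_of_levelData_cube_contOn)

variable {P : Params} {j : ℕ} [DecidableEq (PBond P j)]
variable {A : Type*} [NormedRing A] [NormedAlgebra ℂ A] [CompleteSpace A] [NormOneClass A]
variable {𝒴 𝒴' 𝒳 𝒵 ℬ : Type*} [NormedAddCommGroup 𝒴] [NormedSpace ℂ 𝒴] [CompleteSpace 𝒴]
  [NormedAddCommGroup 𝒴'] [NormedSpace ℂ 𝒴'] [NormedAddCommGroup 𝒳] [NormedSpace ℂ 𝒳] [CompleteSpace 𝒳]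
  [NormedAddCommGroup 𝒵] [NormedSpace ℂ 𝒵] [NormedAddCommGroup ℬ] [NormedSpace ℂ ℬ]

/-- **REALIZED (M1) PER SLOT (`G = SU(2)`) FOR THE CANONICAL LANDAU CLASSIFIER — E2′ WITH `hol`, `hhol`, `hAN`, `hcont`,
`hRad` NO LONGER BINDERS.**  Binders: E2′'s measure-side data and its dictionaries `hRdict`/`hudict` on the chart cube
(with `hol V p` THE DEFINED holonomy in `hudict`), window `hJW`/`hJ` plus `hWS : W V ⊆ closedBall 0 S`, SM-L3 `hGW`,
SM-L4 `hE`, the numbers, SM-L2 `hSM` at `(Rad, H) := (r_Φ/S, e^{m·κ((ε₄+B₀b) + 4C₂B₀(ε₄+B₀b)²)} − 1)`; and, per exterior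
`V` with `V`-UNIFORM constants, the S22 data binders of `ShellMeasureLandauHolonomyChart.hAN_landau_chartRay` ((P2)
`h𝒢`; (P4) `hW`; (118)/(121) `hdom`/`hself`/`hcontr`; (103) `hH₁`; (75) `hΦd`/`hΦ0`/`hΦ`; `hSr : S < r_Φ`; (44) `hC₂`/
`hCq`/`hCd`; scaling `hι`; (46) `hH`; (54) `hq`/`hRC`; read-outs `hκ`/`hℓ`/`hlen`).  CONCLUSION: E2′'s, literally.
Proof: `ShellMeasureLandauHolonomyClamp.slotAC_realized_su2_of_levelData_cube_contOn` with `hcontOn :=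
ShellMeasureLandauHolonomyContinuity.continuousOn_landauHol_chartRay` and `hAN := hAN_landau_chartRay`, per `V`.
A junction; CONDITIONAL on every binder; nothing PRINTED is asserted; NOT Bałaban's minimiser. [folklore] -/
theorem slotAC_realized_su2_landauChart {T : Finset (PBond P j)} (hT : NoClosedLoop T)
    (U₀ : GaugeField P j SU2) (Λ : Finset (PBond P j)) {n : ℕ} (e : ↥Λ × Fin 3 ≃ Fin n)
    {S : ℝ} (hS : 0 < S) (hSπ : 3 * S ^ 2 < Real.pi ^ 2) (c : GaugeField P j SU2 → GaugeField P j SU2)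
    {R : GaugeField P j SU2 → (↥Λ → SU2) → ℝ≥0∞} (hR : ∀ V, Measurable (R V))
    {F : GaugeField P j SU2 → ℝ≥0∞} (hF : Measurable F) (hFi : GaugeInvariant F)
    (hFw : ∀ V y, F (fixTo T U₀ (updateFinset V Λ y)) =
      ENNReal.ofReal (expWindowDensity Λ (c V) S (updateFinset (c V) Λ y)) * R V y)
    (hfin : ∀ V, ((blockLaw Λ).withDensity fun y => F (fixTo T U₀ (updateFinset V Λ y))) univ ≠ ∞)
    {u : GaugeField P j SU2 → ℝ} (hu : Measurable u) (hui : GaugeInvariant u)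
    -- level data per exterior section: trace datum, plaquette index sets, weight words, non-Wilson term, window, co-test
    (Ttr : TraceData A) (hN : 0 < Ttr.N) {ι κ : Type*} {Pu : Finset ι} (hPu : Pu.Nonempty)
    (Pw : Finset κ) (G : GaugeField P j SU2 → κ → (Fin n → ℝ) → A) (𝓔 : GaugeField P j SU2 → (Fin n → ℝ) → ℝ)
    (W : GaugeField P j SU2 → Set (Fin n → ℝ)) (Jco : GaugeField P j SU2 → (Fin n → ℝ) → ℝ≥0∞)
    {θ δ ρ β B𝓔 : ℝ} {sw lw dw : κ → ℝ}
    -- THE SCHEME DATA per exterior section (S22: (P2), (P4), (118)/(121), (103), (75), (44), scaling, (46), (54))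
    (𝒢 : GaugeField P j SU2 → (𝒵 →L[ℂ] 𝒴)) (W𝒱 : GaugeField P j SU2 → 𝒴 → 𝒵) {B₀ C₄ a₃ b ε₄ : ℝ}
    (h𝒢 : ∀ V f, ‖𝒢 V f‖ ≤ B₀ * ‖f‖) (hW : ∀ V, Prop4Hyp (W𝒱 V) C₄ a₃) (hB₀ : 0 < B₀) (hC₄ : 0 ≤ C₄)
    (hε₄ : 0 ≤ ε₄) (hdom : 2 * (ε₄ + B₀ * b) ≤ a₃) (hself : B₀ * C₄ * (ε₄ + B₀ * b) ^ 2 ≤ ε₄)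
    (hcontr : 4 * B₀ * C₄ * (ε₄ + B₀ * b) < 1)
    (H₁ : GaugeField P j SU2 → (ℬ →L[ℂ] 𝒴)) (hH₁ : ∀ V B, ‖H₁ V B‖ ≤ B₀ * ‖B‖)
    (Φ : GaugeField P j SU2 → (Fin n → ℂ) → ℬ) {rΦ : ℝ} (hΦd : ∀ V, DifferentiableOn ℂ (Φ V) (ball 0 rΦ))
    (hΦ0 : ∀ V, Φ V 0 = 0) (hΦ : ∀ V, ∀ z ∈ ball (0 : Fin n → ℂ) rΦ, ‖Φ V z‖ < b) (hSr : S < rΦ)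
    (Cf : GaugeField P j SU2 → 𝒴' → 𝒳) {C₂ RC : ℝ} (hC₂ : 0 ≤ C₂)
    (hCq : ∀ V, ∀ Z : 𝒴', ‖Z‖ < RC → ‖Cf V Z‖ ≤ C₂ * ‖Z‖ ^ 2) (hCd : ∀ V, DifferentiableOn ℂ (Cf V) (ball 0 RC))
    (ιs : GaugeField P j SU2 → (𝒴 →L[ℂ] 𝒴')) (hι : ∀ V Y, ‖ιs V Y‖ ≤ ‖Y‖)
    (Hop : GaugeField P j SU2 → (𝒳 →L[ℂ] 𝒴)) (hH : ∀ V X, ‖Hop V X‖ ≤ B₀ * ‖X‖)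
    (hq : 9 * C₂ * B₀ * (ε₄ + B₀ * b) < 1) (hRC : 3 * (ε₄ + B₀ * b) ≤ RC)
    (ℓs : ι → List (𝒴 →L[ℂ] A)) {κr : ℝ} (hκ : 0 ≤ κr) (hℓ : ∀ p ∈ Pu, ∀ ℓ ∈ ℓs p, ∀ Y, ‖ℓ Y‖ ≤ κr * ‖Y‖)
    {m : ℕ} (hlen : ∀ p ∈ Pu, (ℓs p).length ≤ m)
    -- DICTIONARY (on the chart cube only): block weight, and the tested variable = the CANONICAL Landau classifier
    (hRdict : ∀ V, ∀ x ∈ cube n S,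
      R V (expFibreChart Λ (c V) e x) = Jco V x * weight Ttr β Pw (G V) (𝓔 V) x)
    (hudict : ∀ V, ∀ x ∈ cube n S,
      u (fixTo T U₀ (updateFinset V Λ (expFibreChart Λ (c V) e x))) =
        classifier hPu (fun p => holOf (ℓs p) (fun y => landauExp (Cf V) (ιs V) (Hop V)
          (4 * C₂ * (ε₄ + B₀ * b) ^ 2)
          (solAt (𝒢 V) 0 (W𝒱 V) ε₄ (0 : 𝒵) (H₁ V (Φ V (cplx y))) + H₁ V (Φ V (cplx y))))) x)
    -- SM-L5/L6: kept co-tests supported in the window, centre-monotone; the window inside the chart cube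
    (hJW : ∀ V x, Jco V x ≠ 0 → x ∈ W V)
    (hJ : ∀ V x, ∀ a : ℝ, 0 ≤ a → Jco V x ≤ Jco V (Real.exp (-a) • x))
    (hWS : ∀ V, W V ⊆ closedBall (0 : Fin n → ℝ) S)
    -- SM-L3 graded sectioned words
    (hGW : ∀ V, ∀ x ∈ W V, ∀ p ∈ Pw, ∃ gw : List (MLetter A × ℝ × ℝ), (∀ y ∈ gw, y.1.Good Ttr.τ y.2.1 y.2.2) ∧
      sSum gw ≤ sw p ∧ lSum gw ≤ lw p ∧ mdFro (gw.map Prod.fst) ≤ dw p ∧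
      ∀ c' : ℝ, 0 ≤ c' → c' ≤ 1 → mwordEval c' (gw.map Prod.fst) = G V p (c' • x))
    (hsw1 : ∀ p ∈ Pw, sw p ≤ 1) (hsw0 : ∀ p ∈ Pw, 0 ≤ sw p) (hlw0 : ∀ p ∈ Pw, 0 ≤ lw p)
    (hdw0 : ∀ p ∈ Pw, 0 ≤ dw p)
    -- SM-L4 non-Wilson ray bound
    (hE : ∀ V, ∀ x ∈ W V, ∀ c' : ℝ, 1 / 2 ≤ c' → c' ≤ 1 → 𝓔 V (c' • x) ≤ 𝓔 V x + (1 - c') * B𝓔) (hB𝓔 : 0 ≤ B𝓔)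
    -- numbers + SM-L2 (SM) in the currency `Rad = r_Φ / S`
    (hθ : 0 < θ) (hδ0 : 0 ≤ δ) (hδ1 : δ < 1) (hρ0 : 0 ≤ ρ) (hρ : ρ ≤ (1 - δ) / 2) (hβ : 0 ≤ β)
    (hSM : 36 * (Real.exp (m * (κr * ((ε₄ + B₀ * b) + B₀ * (4 * C₂ * (ε₄ + B₀ * b) ^ 2)))) - 1) * 1 ^ 2 /
      (rΦ / S - 1) ^ 2 ≤ δ * θ) :
    SlotAntiConcentration ((fieldMeasure P j SU2).withDensity F) u θ ρ
      (2 * ((n : ℝ) + (β * ∑ p ∈ Pw, lw p * (dw p + 4 * sw p) + B𝓔)) / (1 - δ)) := by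
  have hRad : 1 < rΦ / S := by rw [lt_div_iff₀ hS]; linarith
  refine slotAC_realized_su2_of_levelData_cube_contOn hT U₀ Λ e hS hSπ c hR hF hFi hFw hfin hu hui Ttr hN hPu
    (fun V p => holOf (ℓs p) (fun y => landauExp (Cf V) (ιs V) (Hop V) (4 * C₂ * (ε₄ + B₀ * b) ^ 2)
      (solAt (𝒢 V) 0 (W𝒱 V) ε₄ (0 : 𝒵) (H₁ V (Φ V (cplx y))) + H₁ V (Φ V (cplx y)))))
    (fun V p _ => continuousOn_landauHol_chartRay hS (h𝒢 V) (hW V) hB₀ hC₄ hε₄ hdom hself hcontr (H₁ V) (hH₁ V)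
      (hΦd V) (hΦ V) hSr hC₂ (hCq V) (hCd V) (ιs V) (hι V) (Hop V) (hH V) hq hRC (ℓs p))
    Pw G 𝓔 W Jco hRdict hudict hJW hJ hRad (fun V => ?_) hGW hsw1 hsw0 hlw0 hdw0 hE hB𝓔 hθ hδ0 hδ1 hρ0 hρ hβ hSM
  exact hAN_landau_chartRay hS (hWS V) (h𝒢 V) (hW V) hB₀ hC₄ hε₄ hdom hself hcontr (H₁ V) (hH₁ V) (hΦd V) (hΦ0 V)
    (hΦ V) hSr hC₂ (hCq V) (hCd V) (ιs V) (hι V) (Hop V) (hH V) hq hRC ℓs hκ hℓ hlen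

/-! ## §2 (v1.1, additive) The same END without the window-in-cube hypothesis -/

/-- **REALIZED (M1) PER SLOT FOR THE CANONICAL LANDAU CLASSIFIER — NO `hWS`** (v1.1, additive).  Word for word
`slotAC_realized_su2_landauChart` except: `hWS : W V ⊆ closedBall 0 S` REMOVED, and SM-L3 `hGW` / SM-L4 `hE` asked for
`x ∈ W V ∩ cube n S` only (weaker); same conclusion.  Proof: the socket
`ShellMeasureLandauHolonomyClamp.slotAC_realized_su2_of_levelData_cube_contOn` at the window `W V ∩ cube n S` and the
co-test `1_cube · Jco V` (the cube is star-shaped, `smul_mem_cube`), with 7″'s `hAN_landau_chartRay` applied to the window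
`W V ∩ cube n S ⊆ closedBall 0 S` (sup norm).  A junction; CONDITIONAL on
every binder; nothing PRINTED is asserted; NOT Bałaban's minimiser. [folklore] -/
theorem slotAC_realized_su2_landauChart' {T : Finset (PBond P j)} (hT : NoClosedLoop T)
    (U₀ : GaugeField P j SU2) (Λ : Finset (PBond P j)) {n : ℕ} (e : ↥Λ × Fin 3 ≃ Fin n)
    {S : ℝ} (hS : 0 < S) (hSπ : 3 * S ^ 2 < Real.pi ^ 2) (c : GaugeField P j SU2 → GaugeField P j SU2)
    {R : GaugeField P j SU2 → (↥Λ → SU2) → ℝ≥0∞} (hR : ∀ V, Measurable (R V))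
    {F : GaugeField P j SU2 → ℝ≥0∞} (hF : Measurable F) (hFi : GaugeInvariant F)
    (hFw : ∀ V y, F (fixTo T U₀ (updateFinset V Λ y)) =
      ENNReal.ofReal (expWindowDensity Λ (c V) S (updateFinset (c V) Λ y)) * R V y)
    (hfin : ∀ V, ((blockLaw Λ).withDensity fun y => F (fixTo T U₀ (updateFinset V Λ y))) univ ≠ ∞)
    {u : GaugeField P j SU2 → ℝ} (hu : Measurable u) (hui : GaugeInvariant u)
    -- level data per exterior section: trace datum, plaquette index sets, weight words, non-Wilson term, window, co-test
    (Ttr : TraceData A) (hN : 0 < Ttr.N) {ι κ : Type*} {Pu : Finset ι} (hPu : Pu.Nonempty)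
    (Pw : Finset κ) (G : GaugeField P j SU2 → κ → (Fin n → ℝ) → A) (𝓔 : GaugeField P j SU2 → (Fin n → ℝ) → ℝ)
    (W : GaugeField P j SU2 → Set (Fin n → ℝ)) (Jco : GaugeField P j SU2 → (Fin n → ℝ) → ℝ≥0∞)
    {θ δ ρ β B𝓔 : ℝ} {sw lw dw : κ → ℝ}
    -- THE SCHEME DATA per exterior section (S22: (P2), (P4), (118)/(121), (103), (75), (44), scaling, (46), (54))
    (𝒢 : GaugeField P j SU2 → (𝒵 →L[ℂ] 𝒴)) (W𝒱 : GaugeField P j SU2 → 𝒴 → 𝒵) {B₀ C₄ a₃ b ε₄ : ℝ}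
    (h𝒢 : ∀ V f, ‖𝒢 V f‖ ≤ B₀ * ‖f‖) (hW : ∀ V, Prop4Hyp (W𝒱 V) C₄ a₃) (hB₀ : 0 < B₀) (hC₄ : 0 ≤ C₄)
    (hε₄ : 0 ≤ ε₄) (hdom : 2 * (ε₄ + B₀ * b) ≤ a₃) (hself : B₀ * C₄ * (ε₄ + B₀ * b) ^ 2 ≤ ε₄)
    (hcontr : 4 * B₀ * C₄ * (ε₄ + B₀ * b) < 1)
    (H₁ : GaugeField P j SU2 → (ℬ →L[ℂ] 𝒴)) (hH₁ : ∀ V B, ‖H₁ V B‖ ≤ B₀ * ‖B‖)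
    (Φ : GaugeField P j SU2 → (Fin n → ℂ) → ℬ) {rΦ : ℝ} (hΦd : ∀ V, DifferentiableOn ℂ (Φ V) (ball 0 rΦ))
    (hΦ0 : ∀ V, Φ V 0 = 0) (hΦ : ∀ V, ∀ z ∈ ball (0 : Fin n → ℂ) rΦ, ‖Φ V z‖ < b) (hSr : S < rΦ)
    (Cf : GaugeField P j SU2 → 𝒴' → 𝒳) {C₂ RC : ℝ} (hC₂ : 0 ≤ C₂)
    (hCq : ∀ V, ∀ Z : 𝒴', ‖Z‖ < RC → ‖Cf V Z‖ ≤ C₂ * ‖Z‖ ^ 2) (hCd : ∀ V, DifferentiableOn ℂ (Cf V) (ball 0 RC))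
    (ιs : GaugeField P j SU2 → (𝒴 →L[ℂ] 𝒴')) (hι : ∀ V Y, ‖ιs V Y‖ ≤ ‖Y‖)
    (Hop : GaugeField P j SU2 → (𝒳 →L[ℂ] 𝒴)) (hH : ∀ V X, ‖Hop V X‖ ≤ B₀ * ‖X‖)
    (hq : 9 * C₂ * B₀ * (ε₄ + B₀ * b) < 1) (hRC : 3 * (ε₄ + B₀ * b) ≤ RC)
    (ℓs : ι → List (𝒴 →L[ℂ] A)) {κr : ℝ} (hκ : 0 ≤ κr) (hℓ : ∀ p ∈ Pu, ∀ ℓ ∈ ℓs p, ∀ Y, ‖ℓ Y‖ ≤ κr * ‖Y‖)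
    {m : ℕ} (hlen : ∀ p ∈ Pu, (ℓs p).length ≤ m)
    -- DICTIONARY (on the chart cube only): block weight, and the tested variable = the CANONICAL Landau classifier
    (hRdict : ∀ V, ∀ x ∈ cube n S,
      R V (expFibreChart Λ (c V) e x) = Jco V x * weight Ttr β Pw (G V) (𝓔 V) x)
    (hudict : ∀ V, ∀ x ∈ cube n S,
      u (fixTo T U₀ (updateFinset V Λ (expFibreChart Λ (c V) e x))) =
        classifier hPu (fun p => holOf (ℓs p) (fun y => landauExp (Cf V) (ιs V) (Hop V)
          (4 * C₂ * (ε₄ + B₀ * b) ^ 2)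
          (solAt (𝒢 V) 0 (W𝒱 V) ε₄ (0 : 𝒵) (H₁ V (Φ V (cplx y))) + H₁ V (Φ V (cplx y))))) x)
    -- SM-L5/L6: kept co-tests supported in the window, centre-monotone (NO `hWS` in v1.1)
    (hJW : ∀ V x, Jco V x ≠ 0 → x ∈ W V)
    (hJ : ∀ V x, ∀ a : ℝ, 0 ≤ a → Jco V x ≤ Jco V (Real.exp (-a) • x))
    -- SM-L3 graded sectioned words
    (hGW : ∀ V, ∀ x ∈ W V ∩ cube n S, ∀ p ∈ Pw,
      ∃ gw : List (MLetter A × ℝ × ℝ), (∀ y ∈ gw, y.1.Good Ttr.τ y.2.1 y.2.2) ∧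
      sSum gw ≤ sw p ∧ lSum gw ≤ lw p ∧ mdFro (gw.map Prod.fst) ≤ dw p ∧
      ∀ c' : ℝ, 0 ≤ c' → c' ≤ 1 → mwordEval c' (gw.map Prod.fst) = G V p (c' • x))
    (hsw1 : ∀ p ∈ Pw, sw p ≤ 1) (hsw0 : ∀ p ∈ Pw, 0 ≤ sw p) (hlw0 : ∀ p ∈ Pw, 0 ≤ lw p)
    (hdw0 : ∀ p ∈ Pw, 0 ≤ dw p)
    -- SM-L4 non-Wilson ray bound
    (hE : ∀ V, ∀ x ∈ W V ∩ cube n S, ∀ c' : ℝ, 1 / 2 ≤ c' → c' ≤ 1 → 𝓔 V (c' • x) ≤ 𝓔 V x + (1 - c') * B𝓔)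
    (hB𝓔 : 0 ≤ B𝓔)
    -- numbers + SM-L2 (SM) in the currency `Rad = r_Φ / S`
    (hθ : 0 < θ) (hδ0 : 0 ≤ δ) (hδ1 : δ < 1) (hρ0 : 0 ≤ ρ) (hρ : ρ ≤ (1 - δ) / 2) (hβ : 0 ≤ β)
    (hSM : 36 * (Real.exp (m * (κr * ((ε₄ + B₀ * b) + B₀ * (4 * C₂ * (ε₄ + B₀ * b) ^ 2)))) - 1) * 1 ^ 2 /
      (rΦ / S - 1) ^ 2 ≤ δ * θ) :
    SlotAntiConcentration ((fieldMeasure P j SU2).withDensity F) u θ ρ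
      (2 * ((n : ℝ) + (β * ∑ p ∈ Pw, lw p * (dw p + 4 * sw p) + B𝓔)) / (1 - δ)) := by
  have hRad : 1 < rΦ / S := by rw [lt_div_iff₀ hS]; linarith
  have hcb : ∀ V, W V ∩ cube n S ⊆ closedBall (0 : Fin n → ℝ) S := by
    intro V x hx
    rw [mem_closedBall_zero_iff]
    exact (pi_norm_le_iff_of_nonneg hS.le).2 fun i => by rw [Real.norm_eq_abs]; exact (mem_cube_iff.1 hx.2) i
  -- E2′ (through the v1 socket) at the window `W V ∩ cube` and the co-test `1_cube · Jco V`
  refine slotAC_realized_su2_of_levelData_cube_contOn hT U₀ Λ e hS hSπ c hR hF hFi hFw hfin hu hui Ttr hN hPu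
    (fun V p => holOf (ℓs p) (fun y => landauExp (Cf V) (ιs V) (Hop V) (4 * C₂ * (ε₄ + B₀ * b) ^ 2)
      (solAt (𝒢 V) 0 (W𝒱 V) ε₄ (0 : 𝒵) (H₁ V (Φ V (cplx y))) + H₁ V (Φ V (cplx y)))))
    (fun V p _ => continuousOn_landauHol_chartRay hS (h𝒢 V) (hW V) hB₀ hC₄ hε₄ hdom hself hcontr (H₁ V) (hH₁ V)
      (hΦd V) (hΦ V) hSr hC₂ (hCq V) (hCd V) (ιs V) (hι V) (Hop V) (hH V) hq hRC (ℓs p))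
    Pw G 𝓔 (fun V => W V ∩ cube n S) (fun V x => (cube n S).indicator (fun _ => (1 : ℝ≥0∞)) x * Jco V x)
    ?_ hudict ?_ ?_ hRad (fun V => ?_) hGW hsw1 hsw0 hlw0 hdw0 hE hB𝓔 hθ hδ0 hδ1 hρ0 hρ hβ hSM
  · intro V x hx
    simp only [indicator_of_mem hx, one_mul]
    exact hRdict V x hx
  · intro V x hx
    refine ⟨hJW V x (right_ne_zero_of_mul hx), ?_⟩
    by_contra h
    exact left_ne_zero_of_mul hx (indicator_of_notMem h _)
  · intro V x a ha
    by_cases hx : x ∈ cube n S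
    · have hx' : Real.exp (-a) • x ∈ cube n S :=
        smul_mem_cube hx (Real.exp_pos _).le (by rw [Real.exp_le_one_iff]; linarith)
      simp only [indicator_of_mem hx, indicator_of_mem hx', one_mul]
      exact hJ V x a ha
    · simp only [indicator_of_notMem hx, zero_mul]
      exact bot_le
  · intro x hx p hp
    exact hAN_landau_chartRay hS (hcb V) (h𝒢 V) (hW V) hB₀ hC₄ hε₄ hdom hself hcontr (H₁ V) (hH₁ V) (hΦd V) (hΦ0 V)
      (hΦ V) hSr hC₂ (hCq V) (hCd V) (ιs V) (hι V) (Hop V) (hH V) hq hRC ℓs hκ hℓ hlen x hx p hp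

end Summit.QuantumFields.BalabanUV.T4Continuum.ShellMeasureLandauHolonomyEnd
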